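import Summits.AtomisticToContinuum.BoseEinsteinCondensation.Theorems.BECInsertionCorrectorCorrectorClosureFactorisationExact
import Summits.AtomisticToContinuum.BoseEinsteinCondensation.Theorems.BECInsertionCorrectorCorrectorClosureGroundStateExists
import Summits.AtomisticToContinuum.BoseEinsteinCondensation.Theorems.BECInsertionCorrectorCorrectorClosureNearMinimiserRigidity
import HarnessLib

/-!
# `CorrectorClosure` reduces to three named factors — the composition of line `residue-area-law`
# as an importable, sorry-free theorem (crux `BECInsertionCorrector.CorrectorClosure`,
# item stmt-AtomisticToContinuum-12058, skeleton v6.1)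

Crux `CorrectorClosure := StaticResponseBound → InsertionResidue` (both sides quantified over all
admissible `v` separately), line `residue-area-law`, registered skeleton v6.1
(`Cruxes/CorrectorClosure/Lines/residue_area_law.lean`, stubs `stub_periodicBEC`,
`stub_removalFidelity`, `stub_unboundedCase`).

The skeleton's glue (`residueFloor_of_factors`, `CorrectorClosure_of`) is sorry-free GIVEN the three
stubs, but lives in the crux work tree with the stubs as `sorry`s. This file lands the same composition
as a THEOREM WITH HYPOTHESES, the three stub signatures verbatim, so that the reduction is kernel-checked,
importable and citable by planners, and so that modus ponens is immediate when any factor lands: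

* `residueFloor_of_factors'` — (K1 → torus BEC of near-minimisers, bounded `v`) and
  (K1 → removal-fidelity floor, bounded `v`) give K1 → the `N`-uniform floor `c₁c₂ ≤ A` on the
  insertion residue `A = L⁻³(∫Θ₀G)²` of the torus Feynman–Kac ground states (`A = f₀·F`, the glue
  direction; the converse inequalities `A ≤ f₀ ≤ 1`, `F ≥ A` are `residue_le_taggedZeroModeOccupation`,
  `taggedZeroModeOccupation_ofReal_le_one`, `residue_mul_le_removalOverlap_sq` of
  `…FactorisationExact`).
* `correctorClosure_of_factors` — the three factors give `CorrectorClosure` BY NAME: unbounded `v` by the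
  third hypothesis; bounded `v` through the landed fixed-`N` frame (`stub_groundStateExists`, p92339;
  `stub_occupationFloorFK_of_window`, p120721, inside `residueFloor_of_factors'`;
  `stub_nearMinimiserRigidity`, p85784, at `ε = c/2`).
* `correctorClosure_of_periodicBEC` — the planner-level form: the UNCONDITIONAL torus-BEC statement
  (the signature of item stmt-AtomisticToContinuum-8997 `PeriodicBEC`, verbatim; the older item
  stmt-AtomisticToContinuum-0826 with the same signature is closed `moot`) together with the two
  route-specific factors gives `CorrectorClosure`. Read with the landed NECESSITY
  `periodicBEC_of_correctorClosure` (`CorrectorClosure → StaticResponseBound → PeriodicBEC-body`, all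
  admissible `v`, p121285): modulo K1 the crux sits between `PeriodicBEC` and
  `PeriodicBEC ∧ removal fidelity ∧ (hard-core case)` — it is a conditional bridge on torus BEC, which is
  why no line of this crux closes without a `K1 ⇒ BEC` mechanism.

No new mathematics: bookkeeping of thresholds (`min ρᵢ`), the shift `N ↦ N+1`
(`tendsto_add_atTop_nat`), and `ℝ≥0∞` arithmetic, exactly as in the registered skeleton.
-/

noncomputable section

open MeasureTheory Filter Matrix
open scoped ENNReal NNReal BigOperators ComplexConjugate

namespace Summit.AtomisticToContinuum.BoseEinsteinCondensation.Theorems.CorrectorClosure.ResidueAreaLaw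

open Literature.MathematicalPhysics.QuantumManyBody.BoseGas
open Summit.AtomisticToContinuum.BoseEinsteinCondensation.Theses.BECInsertionCorrector
open Summit.AtomisticToContinuum.BoseEinsteinCondensation.Theorems.CorrectorClosure.Negative
  (sideLength_succ_pos)
open Summit.AtomisticToContinuum.BoseEinsteinCondensation.Theorems.CorrectorClosure.HealingScaleKacInsertion
  (stub_nearMinimiserRigidity)

/-- **The residue floor from the two factors (hypothesis form of the v6 glue).** If K1 gives torus BEC
of near-minimisers for bounded admissible `v` (factor 1, the body of item stmt-AtomisticToContinuum-8997
under `StaticResponseBound` and boundedness) and K1 gives the removal-fidelity floor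
`c₂ ∫G² ≤ (∫Θ₀G)²` (factor 2), then K1 gives an `N`-uniform floor `c₁c₂ ≤ A = L⁻³(∫_{cell^N} Θ₀ G)²`,
`G(X) = ∫_cell Φ₀(x,X) dx`, on the insertion residue of the torus Feynman–Kac ground states `Θ₀` (`N`
bodies) and `Φ₀` (`N+1` bodies), box `L = sideLength ρ (N+1)`: factor 1 is shifted to index `N+1`
(`tendsto_add_atTop_nat`) and transferred to `f₀(Φ₀) = L⁻³∫G² ≥ c₁` by
`stub_occupationFloorFK_of_window`; then `A ≥ L⁻³ c₂ ∫G² ≥ c₁ c₂`. [folklore] -/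
theorem residueFloor_of_factors'
    (hBEC : StaticResponseBound → ∀ v : ℝ → ℝ≥0∞, IsRepulsiveFiniteRange v →
      (∃ C : ℝ≥0, ∀ r, v r ≤ C) →
      ∃ ρ₀ : ℝ, 0 < ρ₀ ∧ ∀ ρ : ℝ, 0 < ρ → ρ < ρ₀ → ∃ c : ℝ, 0 < c ∧ ∀ᶠ N : ℕ in atTop,
        ∃ δ : ℝ≥0∞, 0 < δ ∧ ∀ Ψ : PeriodicTrialState N (sideLength ρ N),
          periodicEnergy v Ψ ≤ periodicGroundStateEnergy v N (sideLength ρ N) + δ →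
          ENNReal.ofReal (c * N) ≤ condensateOccupation N (sideLength ρ N) Ψ.ψ)
    (hFid : StaticResponseBound → ∀ v : ℝ → ℝ≥0∞, IsRepulsiveFiniteRange v →
      (∃ C : ℝ≥0, ∀ r, v r ≤ C) →
      ∃ ρ₃ : ℝ, 0 < ρ₃ ∧ ∀ ρ : ℝ, 0 < ρ → ρ < ρ₃ → ∃ c₂ : ℝ, 0 < c₂ ∧
        ∀ᶠ N : ℕ in atTop, ∀ (L : ℝ), L = sideLength ρ (N + 1) →
          (∃ C : ℝ≥0, ∀ x, periodizedPotential v L x ≤ C) →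
          ∀ (Θ₀ : Config N → ℝ), IsPeriodicGroundStateFK v L Θ₀ → Continuous Θ₀ → (∀ X, 0 < Θ₀ X) →
          ∀ (Φ₀ : Config (N + 1) → ℝ), IsPeriodicGroundStateFK v L Φ₀ → Continuous Φ₀ →
            (∀ X, 0 < Φ₀ X) →
          ∀ (G : Config N → ℝ), (G = fun X => ∫ x in cell L, Φ₀ (vecCons x X)) →
            ENNReal.ofReal c₂ * ∫⁻ X in cellN N L, ENNReal.ofReal (G X) ^ 2 ≤
              ENNReal.ofReal ((∫ X in cellN N L, Θ₀ X * G X) ^ 2))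
    (hK1 : StaticResponseBound) (v : ℝ → ℝ≥0∞) (hv : IsRepulsiveFiniteRange v)
    (hbdd : ∃ C : ℝ≥0, ∀ r, v r ≤ C) :
    ∃ ρ₂ : ℝ, 0 < ρ₂ ∧ ∀ ρ : ℝ, 0 < ρ → ρ < ρ₂ → ∃ c : ℝ, 0 < c ∧
      ∀ᶠ N : ℕ in atTop, ∀ (L : ℝ), L = sideLength ρ (N + 1) →
        (∃ C : ℝ≥0, ∀ x, periodizedPotential v L x ≤ C) →
        ∀ (Θ₀ : Config N → ℝ), IsPeriodicGroundStateFK v L Θ₀ → Continuous Θ₀ → (∀ X, 0 < Θ₀ X) →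
        ∀ (Φ₀ : Config (N + 1) → ℝ), IsPeriodicGroundStateFK v L Φ₀ → Continuous Φ₀ →
          (∀ X, 0 < Φ₀ X) →
          ENNReal.ofReal c ≤
            ENNReal.ofReal ((L ^ 3)⁻¹ *
              (∫ X in cellN N L, Θ₀ X * ∫ x in cell L, Φ₀ (vecCons x X)) ^ 2) := by
  obtain ⟨ρ₀, hρ₀, hBEC₀⟩ := hBEC hK1 v hv hbdd
  obtain ⟨ρ₃, hρ₃, hFid₀⟩ := hFid hK1 v hv hbdd
  refine ⟨min ρ₀ ρ₃, lt_min hρ₀ hρ₃, fun ρ hρ hρlt => ?_⟩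
  have hρ₀' : ρ < ρ₀ := lt_of_lt_of_le hρlt (min_le_left _ _)
  have hρ₃' : ρ < ρ₃ := lt_of_lt_of_le hρlt (min_le_right _ _)
  obtain ⟨c₁, hc₁, hBECc⟩ := hBEC₀ ρ hρ hρ₀'
  obtain ⟨c₂, hc₂, hFidc⟩ := hFid₀ ρ hρ hρ₃'
  refine ⟨c₁ * c₂, by positivity, ?_⟩
  -- shift the BEC statement to index `N + 1`
  have hBEC' : ∀ᶠ N : ℕ in atTop, ∃ δ : ℝ≥0∞, 0 < δ ∧
      ∀ Ψ : PeriodicTrialState (N + 1) (sideLength ρ (N + 1)),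
        periodicEnergy v Ψ ≤ periodicGroundStateEnergy v (N + 1) (sideLength ρ (N + 1)) + δ →
        ENNReal.ofReal (c₁ * ((N : ℝ) + 1)) ≤
          condensateOccupation (N + 1) (sideLength ρ (N + 1)) Ψ.ψ := by
    have h := (tendsto_add_atTop_nat 1).eventually hBECc
    filter_upwards [h] with N hN
    obtain ⟨δ, hδ, hΨ⟩ := hN
    refine ⟨δ, hδ, fun Ψ hΨE => ?_⟩
    have := hΨ Ψ hΨE
    simpa [Nat.cast_succ] using this
  filter_upwards [hBEC', hFidc] with N hBECN hFidN L hL_def hb Θ₀ hΘ hΘc hΘp Φ₀ hΦ hΦc hΦp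
  have hL : 0 < L := by rw [hL_def]; exact sideLength_succ_pos hρ N
  obtain ⟨δ, hδ, hwin⟩ := hBECN
  set G : Config N → ℝ := fun X => ∫ x in cell L, Φ₀ (vecCons x X) with hG_def
  -- factor 1: `c₁ ≤ f₀(Φ₀)`
  have hf₀ : ENNReal.ofReal c₁ ≤ taggedZeroModeOccupation N L (fun X => (Φ₀ X : ℂ)) := by
    subst hL_def
    exact stub_occupationFloorFK_of_window v hv.1 N _ hL hb Φ₀ hΦ hΦc hΦp c₁ hc₁.le δ hδ hwin
  rw [taggedZeroModeOccupation_ofReal_eq L hΦp] at hf₀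
  -- factor 2: `c₂ ∫ G² ≤ (∫ Θ₀ G)²`
  have hF : ENNReal.ofReal c₂ * ∫⁻ X in cellN N L, ENNReal.ofReal (G X) ^ 2 ≤
      ENNReal.ofReal ((∫ X in cellN N L, Θ₀ X * G X) ^ 2) :=
    hFidN L hL_def hb Θ₀ hΘ hΘc hΘp Φ₀ hΦ hΦc hΦp G rfl
  -- combine: `c₁ c₂ ≤ c₂ · (L³)⁻¹ ∫G² ≤ (L³)⁻¹ (∫Θ₀G)²`
  calc ENNReal.ofReal (c₁ * c₂)
      = ENNReal.ofReal c₂ * ENNReal.ofReal c₁ := by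
        rw [ENNReal.ofReal_mul hc₁.le, mul_comm]
    _ ≤ ENNReal.ofReal c₂ * ((ENNReal.ofReal L ^ 3)⁻¹ *
          ∫⁻ X in cellN N L, ENNReal.ofReal (G X) ^ 2) := by gcongr
    _ = (ENNReal.ofReal L ^ 3)⁻¹ *
          (ENNReal.ofReal c₂ * ∫⁻ X in cellN N L, ENNReal.ofReal (G X) ^ 2) := by ring
    _ ≤ (ENNReal.ofReal L ^ 3)⁻¹ * ENNReal.ofReal ((∫ X in cellN N L, Θ₀ X * G X) ^ 2) := by
        gcongr
    _ = ENNReal.ofReal ((L ^ 3)⁻¹ * (∫ X in cellN N L, Θ₀ X * G X) ^ 2) := by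
        rw [ENNReal.ofReal_mul (by positivity), ENNReal.ofReal_inv_of_pos (by positivity),
          ENNReal.ofReal_pow hL.le]

/-- **`CorrectorClosure` from the three factors of line `residue-area-law` (the registered skeleton's
composition as a theorem).** Hypotheses, verbatim the registered stub signatures of skeleton v6.1:
`hBEC` = `stub_periodicBEC` (K1 → torus BEC of near-minimisers, bounded `v`; the body of item
stmt-AtomisticToContinuum-8997), `hFid` = `stub_removalFidelity` (K1 → removal-fidelity floor, bounded
`v`), `hUnb` = `stub_unboundedCase` (K1 → the body of `InsertionResidue` for unbounded admissible `v`).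
Proof: unbounded `v` by `hUnb`; bounded `v`: thresholds `min ρᵢ`; eventually in `N` the torus FK ground
states exist, are continuous and positive with `v^per` bounded (`stub_groundStateExists`); the floor
`c ≤ A` (`residueFloor_of_factors'`); rigidity at `ε = c/2` (`stub_nearMinimiserRigidity`) moves it to
`c/2 ≤ Res(Θ, Ψ)` for some `δ`-near-minimiser `Θ` and every `δ`-near-minimiser `Ψ`. [folklore] -/
theorem correctorClosure_of_factors
    (hBEC : StaticResponseBound → ∀ v : ℝ → ℝ≥0∞, IsRepulsiveFiniteRange v →
      (∃ C : ℝ≥0, ∀ r, v r ≤ C) →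
      ∃ ρ₀ : ℝ, 0 < ρ₀ ∧ ∀ ρ : ℝ, 0 < ρ → ρ < ρ₀ → ∃ c : ℝ, 0 < c ∧ ∀ᶠ N : ℕ in atTop,
        ∃ δ : ℝ≥0∞, 0 < δ ∧ ∀ Ψ : PeriodicTrialState N (sideLength ρ N),
          periodicEnergy v Ψ ≤ periodicGroundStateEnergy v N (sideLength ρ N) + δ →
          ENNReal.ofReal (c * N) ≤ condensateOccupation N (sideLength ρ N) Ψ.ψ)
    (hFid : StaticResponseBound → ∀ v : ℝ → ℝ≥0∞, IsRepulsiveFiniteRange v →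
      (∃ C : ℝ≥0, ∀ r, v r ≤ C) →
      ∃ ρ₃ : ℝ, 0 < ρ₃ ∧ ∀ ρ : ℝ, 0 < ρ → ρ < ρ₃ → ∃ c₂ : ℝ, 0 < c₂ ∧
        ∀ᶠ N : ℕ in atTop, ∀ (L : ℝ), L = sideLength ρ (N + 1) →
          (∃ C : ℝ≥0, ∀ x, periodizedPotential v L x ≤ C) →
          ∀ (Θ₀ : Config N → ℝ), IsPeriodicGroundStateFK v L Θ₀ → Continuous Θ₀ → (∀ X, 0 < Θ₀ X) →
          ∀ (Φ₀ : Config (N + 1) → ℝ), IsPeriodicGroundStateFK v L Φ₀ → Continuous Φ₀ →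
            (∀ X, 0 < Φ₀ X) →
          ∀ (G : Config N → ℝ), (G = fun X => ∫ x in cell L, Φ₀ (vecCons x X)) →
            ENNReal.ofReal c₂ * ∫⁻ X in cellN N L, ENNReal.ofReal (G X) ^ 2 ≤
              ENNReal.ofReal ((∫ X in cellN N L, Θ₀ X * G X) ^ 2))
    (hUnb : StaticResponseBound → ∀ v : ℝ → ℝ≥0∞, IsRepulsiveFiniteRange v →
      (¬ ∃ C : ℝ≥0, ∀ r, v r ≤ C) →
      ∃ ρ₀ : ℝ, 0 < ρ₀ ∧ ∀ ρ : ℝ, 0 < ρ → ρ < ρ₀ → ∃ c : ℝ, 0 < c ∧ ∀ᶠ N : ℕ in Filter.atTop,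
        ∃ δ : ENNReal, 0 < δ ∧ ∃ Θ : PeriodicTrialState N (sideLength ρ (N + 1)),
          periodicEnergy v Θ ≤ periodicGroundStateEnergy v N (sideLength ρ (N + 1)) + δ ∧
          ∀ Ψ : PeriodicTrialState (N + 1) (sideLength ρ (N + 1)),
            periodicEnergy v Ψ ≤ periodicGroundStateEnergy v (N + 1) (sideLength ρ (N + 1)) + δ →
            ENNReal.ofReal c ≤ ENNReal.ofReal ((sideLength ρ (N + 1) ^ 3)⁻¹) *
              (‖∫ X in cellN N (sideLength ρ (N + 1)), conj (Θ.ψ X) *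
                  ∫ x in cell (sideLength ρ (N + 1)), Ψ.ψ (vecCons x X)‖₊ : ℝ≥0∞) ^ 2) :
    CorrectorClosure := by
  intro hK1 v hv
  by_cases hbdd : ∃ C : ℝ≥0, ∀ r, v r ≤ C
  swap
  · exact hUnb hK1 v hv hbdd
  obtain ⟨ρA, hρA, hGS⟩ := stub_groundStateExists v hv hbdd
  obtain ⟨ρ₂, hρ₂, hFl⟩ := residueFloor_of_factors' hBEC hFid hK1 v hv hbdd
  refine ⟨min ρA ρ₂, lt_min hρA hρ₂, fun ρ hρ hρlt => ?_⟩
  have hρA' : ρ < ρA := lt_of_lt_of_le hρlt (min_le_left _ _)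
  have hρ₂' : ρ < ρ₂ := lt_of_lt_of_le hρlt (min_le_right _ _)
  obtain ⟨c, hc, hFlc⟩ := hFl ρ hρ hρ₂'
  refine ⟨c / 2, by positivity, ?_⟩
  filter_upwards [hGS ρ hρ hρA', hFlc] with N hGSN hFlN
  obtain ⟨hb, ⟨hΘ, hΘc, hΘp⟩, ⟨hΦ, hΦc, hΦp⟩⟩ := hGSN
  set L : ℝ := sideLength ρ (N + 1) with hL_def
  have hL : 0 < L := sideLength_succ_pos hρ N
  set Θ₀ : Config N → ℝ := periodicFKGroundState v N L with hΘ₀_def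
  set Φ₀ : Config (N + 1) → ℝ := periodicFKGroundState v (N + 1) L with hΦ₀_def
  set A : ℝ≥0∞ := ENNReal.ofReal ((L ^ 3)⁻¹ *
      (∫ X in cellN N L, Θ₀ X * ∫ x in cell L, Φ₀ (vecCons x X)) ^ 2) with hA_def
  -- the heart: `c ≤ A`
  have hfloor : ENNReal.ofReal c ≤ A := hFlN L rfl hb Θ₀ hΘ hΘc hΘp Φ₀ hΦ hΦc hΦp
  -- rigidity at `ε = c/2`: transfer to the near-minimiser frame
  obtain ⟨δ, hδ, Θ, hΘE, hΨ⟩ := stub_nearMinimiserRigidity v hv N L hL hb Θ₀ hΘ hΘc hΘp Φ₀ hΦ hΦc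
    hΦp (c / 2) (by positivity)
  refine ⟨δ, hδ, Θ, hΘE, fun Ψ hΨE => ?_⟩
  set R : ℝ≥0∞ := ENNReal.ofReal ((L ^ 3)⁻¹) *
      (‖∫ X in cellN N L, conj (Θ.ψ X) * ∫ x in cell L, Ψ.ψ (vecCons x X)‖₊ : ℝ≥0∞) ^ 2 with hR_def
  have hAR : A ≤ R + ENNReal.ofReal (c / 2) := hΨ Ψ hΨE
  have hsplit : ENNReal.ofReal c = ENNReal.ofReal (c / 2) + ENNReal.ofReal (c / 2) := by
    rw [← ENNReal.ofReal_add (by positivity) (by positivity)]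
    congr 1; ring
  have h2 : ENNReal.ofReal (c / 2) + ENNReal.ofReal (c / 2) ≤ R + ENNReal.ofReal (c / 2) := by
    rw [← hsplit]; exact hfloor.trans hAR
  exact (ENNReal.add_le_add_iff_right ENNReal.ofReal_ne_top).1 h2

/-- **Planner-level form: `CorrectorClosure` is a conditional bridge on torus BEC.** The UNCONDITIONAL
torus-BEC statement — verbatim the signature of item stmt-AtomisticToContinuum-8997 `PeriodicBEC`
(constant-mode occupation `≥ cN` for the `δ`-near-minimisers of the periodic `N`-body energy on the torus
of side `(N/ρ)^{1/3}`, every admissible `v`, `ρ < ρ₀(v)`, `N` large, `δ` after `N`) — together with the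
two route-specific factors (K1 → removal fidelity for bounded `v`; K1 → the target body for unbounded
`v`) gives the crux. Companion of the landed necessity `periodicBEC_of_correctorClosure`
(`CorrectorClosure → StaticResponseBound → PeriodicBEC-body`, p121285). [folklore] -/
theorem correctorClosure_of_periodicBEC
    (hPBEC : ∀ v : ℝ → ℝ≥0∞, IsRepulsiveFiniteRange v →
      ∃ ρ₀ : ℝ, 0 < ρ₀ ∧ ∀ ρ : ℝ, 0 < ρ → ρ < ρ₀ → ∃ c : ℝ, 0 < c ∧ ∀ᶠ N : ℕ in atTop,
        ∃ δ : ℝ≥0∞, 0 < δ ∧ ∀ Ψ : PeriodicTrialState N (sideLength ρ N),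
          periodicEnergy v Ψ ≤ periodicGroundStateEnergy v N (sideLength ρ N) + δ →
          ENNReal.ofReal (c * N) ≤ condensateOccupation N (sideLength ρ N) Ψ.ψ)
    (hFid : StaticResponseBound → ∀ v : ℝ → ℝ≥0∞, IsRepulsiveFiniteRange v →
      (∃ C : ℝ≥0, ∀ r, v r ≤ C) →
      ∃ ρ₃ : ℝ, 0 < ρ₃ ∧ ∀ ρ : ℝ, 0 < ρ → ρ < ρ₃ → ∃ c₂ : ℝ, 0 < c₂ ∧
        ∀ᶠ N : ℕ in atTop, ∀ (L : ℝ), L = sideLength ρ (N + 1) →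
          (∃ C : ℝ≥0, ∀ x, periodizedPotential v L x ≤ C) →
          ∀ (Θ₀ : Config N → ℝ), IsPeriodicGroundStateFK v L Θ₀ → Continuous Θ₀ → (∀ X, 0 < Θ₀ X) →
          ∀ (Φ₀ : Config (N + 1) → ℝ), IsPeriodicGroundStateFK v L Φ₀ → Continuous Φ₀ →
            (∀ X, 0 < Φ₀ X) →
          ∀ (G : Config N → ℝ), (G = fun X => ∫ x in cell L, Φ₀ (vecCons x X)) →
            ENNReal.ofReal c₂ * ∫⁻ X in cellN N L, ENNReal.ofReal (G X) ^ 2 ≤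
              ENNReal.ofReal ((∫ X in cellN N L, Θ₀ X * G X) ^ 2))
    (hUnb : StaticResponseBound → ∀ v : ℝ → ℝ≥0∞, IsRepulsiveFiniteRange v →
      (¬ ∃ C : ℝ≥0, ∀ r, v r ≤ C) →
      ∃ ρ₀ : ℝ, 0 < ρ₀ ∧ ∀ ρ : ℝ, 0 < ρ → ρ < ρ₀ → ∃ c : ℝ, 0 < c ∧ ∀ᶠ N : ℕ in Filter.atTop,
        ∃ δ : ENNReal, 0 < δ ∧ ∃ Θ : PeriodicTrialState N (sideLength ρ (N + 1)),
          periodicEnergy v Θ ≤ periodicGroundStateEnergy v N (sideLength ρ (N + 1)) + δ ∧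
          ∀ Ψ : PeriodicTrialState (N + 1) (sideLength ρ (N + 1)),
            periodicEnergy v Ψ ≤ periodicGroundStateEnergy v (N + 1) (sideLength ρ (N + 1)) + δ →
            ENNReal.ofReal c ≤ ENNReal.ofReal ((sideLength ρ (N + 1) ^ 3)⁻¹) *
              (‖∫ X in cellN N (sideLength ρ (N + 1)), conj (Θ.ψ X) *
                  ∫ x in cell (sideLength ρ (N + 1)), Ψ.ψ (vecCons x X)‖₊ : ℝ≥0∞) ^ 2) :
    CorrectorClosure :=
  correctorClosure_of_factors (fun _ v hv _ => hPBEC v hv) hFid hUnb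

end Summit.AtomisticToContinuum.BoseEinsteinCondensation.Theorems.CorrectorClosure.ResidueAreaLaw

end
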